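import Literature.AlgebraicGeometry.ShimuraVarieties.UnitaryAuxiliaryComplexStructure
import HarnessLib

/-!
# The complex structure `J_{β,Φ}(x)` in an orthogonal frame through the negative line of `x`

[Deligne1979ShimuraVarieties] Prop. 2.3.10 / [Milne2005ShimuraVarieties] Def. 12.5, Rem. 12.6 p. 113 (the special pair of a
line): continuation of ★ `UnitaryAuxiliaryComplexStructure` (`reflJ`, `reflFrame`, `sComp`, `sPhi`, `iPhi`, `blockGL`).  For a
frame `T ∈ GL₃(ℂ)` with `Tᴴ H^τ T = J = diag(1,1,-1)` and a vector `w` with `q(w) ≠ 0`, the transported reflection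
`s = T·r_w·T⁻¹` (★ `reflFrame`) is the `H^τ`-REFLECTION in the line `ℂ·Tw`: it negates `Tw` (`reflFrame_mulVec_frame_self`) and
fixes the `H^τ`-orthogonal complement of `Tw` (`reflFrame_mulVec_of_orthogonal`).  Consequently, for an `H^j`-orthogonal
`M`-frame `B = (b₁|b₂|b₃)` of `V_M` whose third vector spans the negative line of a ball point `x` at the embeddings
`ρ ∈ Φ` over `τ` (`T·lift x ∈ ℂˣ·ρ(b₃)`, the «line point» of ★ `UnitaryCanonicalModel.IsLinePoint`), the `Φ`-components
of Deligne's `s_x` are diagonal in the frame: `s_ρ·B^ρ = B^ρ·diag(1,1,ε_ρ)`, `ε_ρ = -1` over `τ` and `+1` elsewhere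
(`sComp_mul_frame_eq`), and the block matrix `A = diag(iPhi, iPhi·s_x)` of `h_W(i)` on `(W₀ ⊕ V_M) ⊗ ℝ` satisfies
`A·P_ℝ = P_ℝ·diag(iPhi; iPhi, iPhi, iPhi·ε)` for `P = diag(1, B)` (`blockGL_iPhi_sPhi_mul_frame_eq`) — the complex structure of
the special pair of the line is DIAGONAL in the CM frame, with eigencharacter data `(Φ; Φ, Φ, Φ^τ̄)`.

(build-touch 2026-08-28T15:58Z: re-commit to trigger the batch builder; declarations byte-identical to commit 7dec7f80bcf3.)
-/

noncomputable section

open Matrix NumberField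
open scoped TensorProduct ComplexConjugate Classical

namespace Literature.AlgebraicGeometry.ShimuraVarieties.UnitaryCanonicalModel.Aux

open Literature.Geometry.ComplexHyperbolic

section ReflectionFrame

variable (T : GL (Fin 3) ℂ) {w : Fin 3 → ℂ}

/-- `r_w·w = -w`: the `J`-reflection negates its defining vector. [cite: Deligne1979ShimuraVarieties, Prop. 2.3.10 (PDF p. 32)] -/
theorem reflJ_mulVec_self (hw : formJ w ≠ 0) : reflJ w *ᵥ w = -w := by
  rw [reflJ, Matrix.sub_mulVec, Matrix.one_mulVec, Matrix.smul_mulVec, projJ, Matrix.smul_mulVec,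
    Matrix.vecMulVec_mulVec, ← Matrix.dotProduct_mulVec, op_smul_eq_smul]
  change w - (2 : ℂ) • ((formJ w)⁻¹ • (formJ w • w)) = -w
  rw [smul_smul (formJ w)⁻¹, inv_mul_cancel₀ hw, one_smul, two_smul]
  abel

/-- `s·(T w) = -(T w)`: the transported reflection `s = T·r_w·T⁻¹` negates the vector `u = T w` spanning its line.
[cite: Deligne1979ShimuraVarieties, Prop. 2.3.10 (PDF p. 32)] -/
theorem reflFrame_mulVec_frame_self (hw : formJ w ≠ 0) :
    reflFrame T w *ᵥ ((T : Matrix (Fin 3) (Fin 3) ℂ) *ᵥ w) = -((T : Matrix (Fin 3) (Fin 3) ℂ) *ᵥ w) := by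
  have h1 : ((T⁻¹ : GL (Fin 3) ℂ) : Matrix (Fin 3) (Fin 3) ℂ) *ᵥ ((T : Matrix (Fin 3) (Fin 3) ℂ) *ᵥ w) = w := by
    rw [Matrix.mulVec_mulVec, ← Units.val_mul, inv_mul_cancel, Units.val_one, Matrix.one_mulVec]
  rw [reflFrame, ← Matrix.mulVec_mulVec, ← Matrix.mulVec_mulVec, h1, reflJ_mulVec_self hw, Matrix.mulVec_neg]

/-- **The transported reflection fixes the `K`-orthogonal complement of `u = T w`** when `Tᴴ K T = J`: if `uᴴ K y = 0`
then `s·y = y` (`s = T r_w T⁻¹` is the `K`-reflection in the line `ℂu`). [cite: Deligne1979ShimuraVarieties, Prop. 2.3.10 (PDF p. 32)] -/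
theorem reflFrame_mulVec_of_orthogonal {K : Matrix (Fin 3) (Fin 3) ℂ}
    (hT : ((T : Matrix (Fin 3) (Fin 3) ℂ))ᴴ * K * (T : Matrix (Fin 3) (Fin 3) ℂ) = BallModel.J) {y : Fin 3 → ℂ}
    (hy : star ((T : Matrix (Fin 3) (Fin 3) ℂ) *ᵥ w) ⬝ᵥ (K *ᵥ y) = 0) : reflFrame T w *ᵥ y = y := by
  have hJTi : BallModel.J * ((T⁻¹ : GL (Fin 3) ℂ) : Matrix (Fin 3) (Fin 3) ℂ) =
      ((T : Matrix (Fin 3) (Fin 3) ℂ))ᴴ * K := by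
    rw [← hT, Matrix.mul_assoc, Matrix.mul_assoc, ← Units.val_mul, mul_inv_cancel, Units.val_one, Matrix.mul_one]
  have hq : (star w ᵥ* BallModel.J) ⬝ᵥ (((T⁻¹ : GL (Fin 3) ℂ) : Matrix (Fin 3) (Fin 3) ℂ) *ᵥ y) = 0 := by
    rw [← Matrix.dotProduct_mulVec, Matrix.mulVec_mulVec, hJTi, ← Matrix.mulVec_mulVec, Matrix.dotProduct_mulVec,
      ← Matrix.star_mulVec, hy]
  rw [reflFrame, ← Matrix.mulVec_mulVec, ← Matrix.mulVec_mulVec, reflJ, Matrix.sub_mulVec, Matrix.one_mulVec,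
    Matrix.smul_mulVec, projJ, Matrix.smul_mulVec, Matrix.vecMulVec_mulVec, hq, MulOpposite.op_zero, zero_smul,
    smul_zero, smul_zero, sub_zero, Matrix.mulVec_mulVec, ← Units.val_mul, mul_inv_cancel, Units.val_one,
    Matrix.one_mulVec]

/-- **The reflection in an orthogonal frame through the negative line.** If `Tᴴ K T = J`, the columns of `Bc` are
pairwise `K`-orthogonal, and the negative vector `T w` spans the line of the third column (`T w = c·Bc e₂`, `c ≠ 0`),
then `s = T·r_w·T⁻¹` is `diag(1, 1, -1)` in the frame `Bc`: `s·Bc = Bc·diag(1,1,-1)`.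
[cite: Deligne1979ShimuraVarieties, Prop. 2.3.10 (PDF p. 32)] [cite: Milne2005ShimuraVarieties, Def. 12.5 and Rem. 12.6 p. 113] -/
theorem reflFrame_mul_eq_of_orthogonal_of_line {K : Matrix (Fin 3) (Fin 3) ℂ}
    (hT : ((T : Matrix (Fin 3) (Fin 3) ℂ))ᴴ * K * (T : Matrix (Fin 3) (Fin 3) ℂ) = BallModel.J) (hw : formJ w ≠ 0)
    (Bc : Matrix (Fin 3) (Fin 3) ℂ)
    (horth : ∀ k l : Fin 3, k ≠ l → star (fun i => Bc i k) ⬝ᵥ (K *ᵥ fun i => Bc i l) = 0)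
    {c : ℂ} (hc : c ≠ 0) (hline : (T : Matrix (Fin 3) (Fin 3) ℂ) *ᵥ w = c • fun i => Bc i 2) :
    reflFrame T w * Bc = Bc * BallModel.J := by
  ext i k
  rw [BallModel.J, Matrix.mul_diagonal]
  change (reflFrame T w *ᵥ fun i => Bc i k) i = _
  by_cases hk : k = 2
  · subst hk
    have hcol : (fun i => Bc i 2) = c⁻¹ • ((T : Matrix (Fin 3) (Fin 3) ℂ) *ᵥ w) := by
      rw [hline, smul_smul, inv_mul_cancel₀ hc, one_smul]
    have h2 : Bc i 2 = c⁻¹ * ((T : Matrix (Fin 3) (Fin 3) ℂ) *ᵥ w) i := by simpa using congrFun hcol i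
    rw [hcol, Matrix.mulVec_smul, reflFrame_mulVec_frame_self T hw, h2]
    simp
  · have hy : star ((T : Matrix (Fin 3) (Fin 3) ℂ) *ᵥ w) ⬝ᵥ (K *ᵥ fun i => Bc i k) = 0 := by
      rw [hline, star_smul, smul_dotProduct, horth 2 k (Ne.symm hk), smul_zero]
    rw [reflFrame_mulVec_of_orthogonal T hT hy]
    fin_cases k <;> simp at hk ⊢

end ReflectionFrame

/-! ### The `Φ`-components `s_ρ` in an `H^j`-orthogonal `M`-frame through the line -/

section Components

variable {L : Type} [Field L] {M : Type} [Field M] [NumberField M] [IsCMField M] (j : L →+* M)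
  (H : Matrix (Fin 3) (Fin 3) L) (Φ : Literature.AlgebraicGeometry.Motives.CMType M) (τ : L →+* ℂ) (T : GL (Fin 3) ℂ)

/-- `(Xᴴ·K·X)_{kl} = (X e_k)ᴴ·K·(X e_l)`. [cite: Deligne1979ShimuraVarieties, Prop. 2.3.10 (PDF p. 32)] -/
private theorem conjTranspose_mul_mul_apply (X K : Matrix (Fin 3) (Fin 3) ℂ) (k l : Fin 3) :
    (Xᴴ * K * X) k l = star (fun i => X i k) ⬝ᵥ (K *ᵥ fun i => X i l) := by
  rw [Matrix.mul_assoc, Matrix.mul_apply]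
  rfl

/-- The `ρ`-image of the `M`-sesquilinear Gram entry: `ρ((ᵗc(B)·H^j·B)_{kl}) = ((B^ρ)ᴴ·H^{ρ∘j}·B^ρ)_{kl}`
(every `ρ` intertwines `c` with complex conjugation, Mathlib `IsCMField.complexEmbedding_complexConj`).
[cite: Deligne1979ShimuraVarieties, 2.3.9 (PDF p. 32)] -/
theorem map_transpose_map_complexConj_mul_mul (ρ : M →+* ℂ) (B : Matrix (Fin 3) (Fin 3) M) (k l : Fin 3) :
    ρ (((B.map (IsCMField.complexConj M))ᵀ * H.map j * B) k l) =
      ((B.map ρ)ᴴ * H.map (ρ.comp j) * B.map ρ) k l := by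
  simp only [Matrix.mul_apply, Matrix.transpose_apply, Matrix.map_apply, Matrix.conjTranspose_apply, map_sum,
    map_mul, IsCMField.complexEmbedding_complexConj, RingHom.coe_comp, Function.comp_apply, Complex.star_def]

/-- **`s_ρ` in the frame `B^ρ`**: at every `ρ ∈ Φ`, `s_ρ·B^ρ = B^ρ·diag(1, 1, ε_ρ)` with `ε_ρ = -1` if `ρ ∘ j = τ` and
`ε_ρ = 1` otherwise — for an `H^j`-orthogonal `M`-frame `B` of `V_M` whose third vector spans, at the `ρ` over `τ`, the
negative line of the point `x` (`T·lift x ∈ ℂˣ·ρ(B e₂)`). [cite: Deligne1979ShimuraVarieties, Prop. 2.3.10 (PDF p. 32)]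
[cite: Milne2005ShimuraVarieties, Def. 12.5 and Rem. 12.6 p. 113] -/
theorem sComp_mul_frame_eq (hT : ((T : Matrix (Fin 3) (Fin 3) ℂ))ᴴ * H.map τ * (T : Matrix (Fin 3) (Fin 3) ℂ) = BallModel.J)
    (x : BallModel.Ball) (B : Matrix (Fin 3) (Fin 3) M)
    (hB : ∀ k l : Fin 3, k ≠ l → ((B.map (IsCMField.complexConj M))ᵀ * H.map j * B) k l = 0) (ρ : Φ.1)
    (hline : ρ.1.comp j = τ → ∃ c : ℂ, c ≠ 0 ∧
      (T : Matrix (Fin 3) (Fin 3) ℂ) *ᵥ BallModel.lift x = c • fun i => ρ.1 (B i 2)) :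
    sComp M j Φ τ T (BallModel.lift x) ρ * B.map ρ.1 =
      B.map ρ.1 * Matrix.diagonal (fun k : Fin 3 => if k = 2 then (if ρ.1.comp j = τ then (-1 : ℂ) else 1) else 1) := by
  by_cases hρ : ρ.1.comp j = τ
  · obtain ⟨c, hc, hcx⟩ := hline hρ
    have horth : ∀ k l : Fin 3, k ≠ l →
        star (fun i => B.map ρ.1 i k) ⬝ᵥ (H.map τ *ᵥ fun i => B.map ρ.1 i l) = 0 := by
      intro k l hkl
      rw [← conjTranspose_mul_mul_apply, ← hρ, ← map_transpose_map_complexConj_mul_mul j H ρ.1 B k l, hB k l hkl,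
        map_zero]
    have hJ : BallModel.J = Matrix.diagonal (fun k : Fin 3 => if k = 2 then (if ρ.1.comp j = τ then (-1 : ℂ) else 1) else 1) := by
      rw [BallModel.J, if_pos hρ]
      congr 1
      funext k
      fin_cases k <;> simp
    rw [sComp_of_eq _ hρ, ← hJ]
    exact reflFrame_mul_eq_of_orthogonal_of_line T hT (formJ_lift_ne_zero x) (B.map ρ.1) horth hc
      (by rw [hcx]; rfl)
  · have h1 : Matrix.diagonal (fun k : Fin 3 => if k = 2 then (if ρ.1.comp j = τ then (-1 : ℂ) else 1) else 1) = 1 := by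
      rw [if_neg hρ, ← Matrix.diagonal_one]
      congr 1
      funext k
      split_ifs <;> rfl
    rw [sComp_of_ne _ hρ, h1, Matrix.one_mul, Matrix.mul_one]

end Components

/-! ### `diag(iPhi, iPhi·s_x)` is diagonal in the frame `diag(1, B)` of `(W₀ ⊕ V_M) ⊗ ℝ` -/

section BlockDiagonal

variable {L : Type} [Field L] (M : Type) [Field M] [NumberField M] [IsCMField M] (j : L →+* M)
  (H : Matrix (Fin 3) (Fin 3) L) (Φ : Literature.AlgebraicGeometry.Motives.CMType M) (τ : L →+* ℂ) (T : GL (Fin 3) ℂ)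

/-- **`A = diag(iPhi, iPhi·s_x)` is DIAGONAL in the `M`-frame `P = diag(1, B)`: `A·P_ℝ = P_ℝ·diag(u)`** in
`M_{1⊕3}(ℝ ⊗_ℚ M)`, with `u = (iPhi; iPhi, iPhi, iPhi·ε)` and `ε ∈ ℝ ⊗_ℚ M` the element with `Φ`-components `-1` at
the `ρ` over `τ` and `+1` elsewhere — for an `H^j`-orthogonal frame `B` through the line of the point `x`
(checked on `Φ`-components by ★ `matrix_eq_of_realEmb_eq` and `sComp_mul_frame_eq`).
[cite: Deligne1979ShimuraVarieties, Prop. 2.3.10 (PDF p. 32)] [cite: Milne2005ShimuraVarieties, Def. 12.5 and Rem. 12.6 p. 113] -/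
theorem blockGL_iPhi_sPhi_mul_frame_eq
    (hT : ((T : Matrix (Fin 3) (Fin 3) ℂ))ᴴ * H.map τ * (T : Matrix (Fin 3) (Fin 3) ℂ) = BallModel.J)
    (x : BallModel.Ball) (B : GL (Fin 3) M)
    (hB : ∀ k l : Fin 3, k ≠ l →
      (((B : Matrix (Fin 3) (Fin 3) M).map (IsCMField.complexConj M))ᵀ * H.map j * (B : Matrix (Fin 3) (Fin 3) M)) k l = 0)
    (hline : ∀ ρ : Φ.1, ρ.1.comp j = τ → ∃ c : ℂ, c ≠ 0 ∧
      (T : Matrix (Fin 3) (Fin 3) ℂ) *ᵥ BallModel.lift x = c • fun i => ρ.1 ((B : Matrix (Fin 3) (Fin 3) M) i 2)) :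
    ((blockGL (ℝ ⊗[ℚ] M) (iPhi M Φ, sPhi M j Φ τ T x) : GL (Fin 1 ⊕ Fin 3) (ℝ ⊗[ℚ] M)) :
          Matrix (Fin 1 ⊕ Fin 3) (Fin 1 ⊕ Fin 3) (ℝ ⊗[ℚ] M)) *
        ((blockGL M (1, B) : GL (Fin 1 ⊕ Fin 3) M) : Matrix (Fin 1 ⊕ Fin 3) (Fin 1 ⊕ Fin 3) M).map
          (Algebra.TensorProduct.includeRight : M →ₐ[ℚ] ℝ ⊗[ℚ] M) =
      ((blockGL M (1, B) : GL (Fin 1 ⊕ Fin 3) M) : Matrix (Fin 1 ⊕ Fin 3) (Fin 1 ⊕ Fin 3) M).map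
          (Algebra.TensorProduct.includeRight : M →ₐ[ℚ] ℝ ⊗[ℚ] M) *
        Matrix.diagonal (fun p : Fin 1 ⊕ Fin 3 => iPhiVal M Φ *
          Sum.elim (fun _ => (1 : ℝ ⊗[ℚ] M))
            (fun k => if k = 2 then (realPiEquiv M Φ).symm (fun φ => if φ.1.comp j = τ then (-1 : ℂ) else 1) else 1) p) := by
  apply matrix_eq_of_realEmb_eq M Φ
  intro ρ
  have hP : (((blockGL M (1, B) : GL (Fin 1 ⊕ Fin 3) M) : Matrix (Fin 1 ⊕ Fin 3) (Fin 1 ⊕ Fin 3) M).map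
        (Algebra.TensorProduct.includeRight : M →ₐ[ℚ] ℝ ⊗[ℚ] M)).map (realEmb M Φ ρ) =
      Matrix.fromBlocks 1 0 0 ((B : Matrix (Fin 3) (Fin 3) M).map ρ.1) := by
    rw [map_includeRight_map_realEmb, coe_blockGL, Units.val_one, one_smul, one_smul, Matrix.fromBlocks_map,
      Matrix.map_one ρ.1 (map_zero _) (map_one _), Matrix.map_zero ρ.1 (map_zero _), Matrix.map_zero ρ.1 (map_zero _)]
  have hd : (fun p : Fin 1 ⊕ Fin 3 => realEmb M Φ ρ (iPhiVal M Φ *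
        Sum.elim (fun _ => (1 : ℝ ⊗[ℚ] M))
          (fun k => if k = 2 then (realPiEquiv M Φ).symm (fun φ => if φ.1.comp j = τ then (-1 : ℂ) else 1) else 1) p)) =
      Sum.elim (fun _ => Complex.I)
        (fun k => Complex.I * (if k = 2 then (if ρ.1.comp j = τ then (-1 : ℂ) else 1) else 1)) := by
    funext p
    rcases p with p | k
    · simp only [Sum.elim_inl, mul_one, realEmb_iPhiVal]
    · simp only [Sum.elim_inr, map_mul, realEmb_iPhiVal]
      congr 1
      by_cases hk : k = 2
      · rw [if_pos hk, if_pos hk, realEmb_apply, realPi_symm_apply]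
      · rw [if_neg hk, if_neg hk, map_one]
  rw [Matrix.map_mul, Matrix.map_mul, hP, coe_blockGL_iPhi_sPhi_map_realEmb, Matrix.diagonal_map (map_zero _)]
  change _ = _ * Matrix.diagonal (fun p => realEmb M Φ ρ _)
  rw [hd, ← Matrix.fromBlocks_diagonal, Matrix.fromBlocks_multiply, Matrix.fromBlocks_multiply]
  simp only [Matrix.mul_zero, Matrix.zero_mul, add_zero, zero_add, Matrix.mul_one, Matrix.one_mul]
  refine Matrix.fromBlocks_inj.2 ⟨?_, rfl, rfl, ?_⟩
  · ext a b
    simp [Matrix.one_apply, Matrix.diagonal_apply, Matrix.smul_apply]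
  · rw [Matrix.smul_mul, sComp_mul_frame_eq j H Φ τ T hT x (B : Matrix (Fin 3) (Fin 3) M) hB ρ (hline ρ),
      ← Matrix.mul_smul, ← Matrix.diagonal_smul]
    rfl

end BlockDiagonal

end Literature.AlgebraicGeometry.ShimuraVarieties.UnitaryCanonicalModel.Aux

end
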